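import Mathlib
import Literature.NumberTheory.Transcendental.KZProduct
import Literature.NumberTheory.Transcendental.KZSemiCanonicalReductionProofs
import Literature.NumberTheory.Transcendental.KZSubcalculusInvariants
import Summits.KontsevichZagierPeriods.KontsevichZagierPeriods.Theorems.SoloInformedPolyJacobian
import Summits.KontsevichZagierPeriods.KontsevichZagierPeriods.Theorems.SoloInformedKZStokesCells
import Summits.KontsevichZagierPeriods.KontsevichZagierPeriods.Theorems.SoloInformedPiDiscQuarters
import HarnessLib
import HarnessLib.Audit

/-!
# SoloInformed — `π = 4 ∫₀¹ dt/(1+t²)` inside the literal Kontsevich–Zagier calculus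

Kontsevich–Zagier open §1.1 of *Periods* with `π = ∬_{x²+y²≤1} dx dy = … = ∫ dx/(1+x²)` and
remark that each equality is an instance of their three rules. This file proves that remark for
the audited four-move calculus `Literature.NumberTheory.Transcendental.KZ.relations`
(`KZCalculus.lean`): the class of the disc representation `KZ.piRep = [{x²+y²≤1}, 1]` equals
four times the class of the arctangent representation `[[0,1], 1/(1+t²)]`,

  `soloInformed_piRep_sub_four_nsmul_arctanRep_mem_relations :
      of piRep - 4 • of soloInformedArctanRep ∈ KZ.relations`.

The chain of moves (all with `ℚ`-polynomial data, no square roots; steps 1–2 are carried out in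
`SoloInformedPiDiscQuarters`, steps 3–5 and the assembly here):

1. rule (1a): the disc is the almost-disjoint union of its four open-quadrant quarters
   (`KZ.of_sub_sum_of_mem_relations`, the axes being null);
2. rule (2) three times: the sign flips `(x, y) ↦ (±x, ±y)` (linear involutions, `|det| = 1`)
   identify the four quarters;
3. rule (2): the *polynomial polar map* `Φ(s, ρ) = (ρ(1 − s²), 2ρs)` (`s = tan(φ/2)`,
   `ρ(1+s²) = r`) maps `{0 < s < 1, 0 < ρ, ρ(1+s²) ≤ 1}` injectively onto the open first quarter
   of the closed disc, with `|det Φ'| = 2ρ(1+s²)`;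
4. rule (1a): closing the source up to a null set gives the band
   `{0 ≤ s ≤ 1, 0 ≤ ρ ≤ 1/(1+s²)}`;
5. rule (3) (Newton–Leibniz along `ρ`, primitive `F = ρ²(1+s²)`): the band representation
   `[band, 2ρ(1+s²)]` is equivalent to `[[0,1], 1/(1+s²)]`.

Residency `solo-KontsevichZagierPeriods-informed` (PLAN.md, session s15: identification of the
class `θ₀` of `SoloInformedLocSplitTheta` with `2[π]`).
References: M. Kontsevich, D. Zagier, *Periods* (2001), §1.1–§1.2.
-/

noncomputable section

open MeasureTheory Set Filter
open scoped Topology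

namespace Summit.KontsevichZagierPeriods.KontsevichZagierPeriods.Theorems

open Literature.NumberTheory.Transcendental Literature.NumberTheory.Transcendental.KZ
open Literature.ModelTheory.ExponentialFields (IsSemialgebraic isSemialgebraic_setOf_eval_le
  isSemialgebraic_setOf_eval_lt isSemialgebraic_setOf_eval_pos)

/-! ### Step 3: the polynomial polar map -/

/-- The components of the polynomial polar map: `(ρ(1 − s²), 2ρs)` in the variables
`s = X 0`, `ρ = X 1`. -/
def soloInformedPolarPoly : Fin 2 → MvPolynomial (Fin 2) ℚ :=
  ![MvPolynomial.X 1 * (1 - MvPolynomial.X 0 ^ 2),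
    MvPolynomial.C 2 * (MvPolynomial.X 0 * MvPolynomial.X 1)]

/-- The polynomial polar map `Φ(s, ρ) = (ρ(1 − s²), 2ρs)`. -/
def soloInformedPolar : (Fin 2 → ℝ) → (Fin 2 → ℝ) := soloInformedPolyMap soloInformedPolarPoly

/-- First component of the polar map. -/
@[simp] theorem soloInformedPolar_apply_zero (u : Fin 2 → ℝ) :
    soloInformedPolar u 0 = u 1 * (1 - u 0 ^ 2) := by
  simp [soloInformedPolar, soloInformedPolarPoly]

/-- Second component of the polar map. -/
@[simp] theorem soloInformedPolar_apply_one (u : Fin 2 → ℝ) :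
    soloInformedPolar u 1 = 2 * (u 0 * u 1) := by
  simp [soloInformedPolar, soloInformedPolarPoly]

/-- **Jacobian determinant of the polar map**: `det Φ'(s, ρ) = −2ρ(1 + s²)`. -/
theorem soloInformed_det_polar (u : Fin 2 → ℝ) :
    (soloInformedJacCLM soloInformedPolarPoly u).det = -(2 * u 1 * (1 + u 0 ^ 2)) := by
  rw [soloInformed_det_jacCLM, Matrix.det_fin_two]
  simp [soloInformedJacMat_apply, soloInformedPolarPoly]
  ring

/-- The source of the polar map: `{0 < s < 1, 0 < ρ, ρ(1 + s²) ≤ 1}`. -/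
def soloInformedPolarSrc : Set (Fin 2 → ℝ) :=
  {u | 0 < u 0 ∧ u 0 < 1 ∧ 0 < u 1 ∧ u 1 * (1 + u 0 ^ 2) ≤ 1}

/-- The closed band `{0 ≤ s ≤ 1, 0 ≤ ρ, ρ(1 + s²) ≤ 1}`. -/
def soloInformedPolarBand : Set (Fin 2 → ℝ) :=
  {u | (0 ≤ u 0 ∧ u 0 ≤ 1) ∧ 0 ≤ u 1 ∧ u 1 * (1 + u 0 ^ 2) ≤ 1}

/-- The source is `ℚ`-semialgebraic. -/
theorem isSemialgebraic_soloInformedPolarSrc : IsSemialgebraic ℚ soloInformedPolarSrc := by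
  have h1 := isSemialgebraic_setOf_eval_lt (k := ℚ) (R := ℝ) (0 : MvPolynomial (Fin 2) ℚ)
    (MvPolynomial.X 0)
  have h2 := isSemialgebraic_setOf_eval_lt (k := ℚ) (R := ℝ)
    (MvPolynomial.X 0 : MvPolynomial (Fin 2) ℚ) 1
  have h3 := isSemialgebraic_setOf_eval_lt (k := ℚ) (R := ℝ) (0 : MvPolynomial (Fin 2) ℚ)
    (MvPolynomial.X 1)
  have h4 := isSemialgebraic_setOf_eval_le (k := ℚ) (R := ℝ)
    (MvPolynomial.X 1 * (1 + MvPolynomial.X 0 ^ 2) : MvPolynomial (Fin 2) ℚ) 1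
  have h := h1.inter (h2.inter (h3.inter h4))
  simp only [map_zero, map_one, map_mul, map_add, map_pow, MvPolynomial.aeval_X] at h
  have hset : soloInformedPolarSrc = {u : Fin 2 → ℝ | 0 < u 0} ∩ ({u | u 0 < 1} ∩
      ({u | 0 < u 1} ∩ {u | u 1 * (1 + u 0 ^ 2) ≤ 1})) := by
    ext u; simp [soloInformedPolarSrc]
  rw [hset]
  exact h

/-- The band is `ℚ`-semialgebraic. -/
theorem isSemialgebraic_soloInformedPolarBand : IsSemialgebraic ℚ soloInformedPolarBand := by
  have h1 := isSemialgebraic_setOf_eval_le (k := ℚ) (R := ℝ) (0 : MvPolynomial (Fin 2) ℚ)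
    (MvPolynomial.X 0)
  have h2 := isSemialgebraic_setOf_eval_le (k := ℚ) (R := ℝ)
    (MvPolynomial.X 0 : MvPolynomial (Fin 2) ℚ) 1
  have h3 := isSemialgebraic_setOf_eval_le (k := ℚ) (R := ℝ) (0 : MvPolynomial (Fin 2) ℚ)
    (MvPolynomial.X 1)
  have h4 := isSemialgebraic_setOf_eval_le (k := ℚ) (R := ℝ)
    (MvPolynomial.X 1 * (1 + MvPolynomial.X 0 ^ 2) : MvPolynomial (Fin 2) ℚ) 1
  have h := (h1.inter h2).inter (h3.inter h4)
  simp only [map_zero, map_one, map_mul, map_add, map_pow, MvPolynomial.aeval_X] at h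
  have hset : soloInformedPolarBand = ({u : Fin 2 → ℝ | 0 ≤ u 0} ∩ {u | u 0 ≤ 1}) ∩
      ({u | 0 ≤ u 1} ∩ {u | u 1 * (1 + u 0 ^ 2) ≤ 1}) := by
    ext u; simp [soloInformedPolarBand]
  rw [hset]
  exact h

/-- The band is compact (a closed subset of `[0,1]²`). -/
theorem isCompact_soloInformedPolarBand : IsCompact soloInformedPolarBand := by
  refine (isCompact_Icc : IsCompact (Icc (0 : Fin 2 → ℝ) 1)).of_isClosed_subset ?_ ?_
  · have hset : soloInformedPolarBand = ({u : Fin 2 → ℝ | 0 ≤ u 0} ∩ {u | u 0 ≤ 1}) ∩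
        ({u | 0 ≤ u 1} ∩ {u | u 1 * (1 + u 0 ^ 2) ≤ 1}) := by
      ext u; simp [soloInformedPolarBand]
    rw [hset]
    exact ((isClosed_le continuous_const (continuous_apply 0)).inter
      (isClosed_le (continuous_apply 0) continuous_const)).inter
      ((isClosed_le continuous_const (continuous_apply 1)).inter
        (isClosed_le ((continuous_apply 1).mul (continuous_const.add
          ((continuous_apply 0).pow 2))) continuous_const))
  · rintro u ⟨⟨h0, h0'⟩, h1, h2⟩
    simp only [mem_Icc, Pi.le_def, Pi.zero_apply, Pi.one_apply, Fin.forall_fin_two]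
    exact ⟨⟨h0, h1⟩, h0', by nlinarith [sq_nonneg (u 0)]⟩

/-- The source lies in the band. -/
theorem soloInformedPolarSrc_subset_band : soloInformedPolarSrc ⊆ soloInformedPolarBand :=
  fun _ ⟨h0, h0', h1, h2⟩ => ⟨⟨h0.le, h0'.le⟩, h1.le, h2⟩

/-- The band representation `[band, 2ρ(1 + s²)]`. -/
def soloInformedPolarBandRep : IntegralRep 2 where
  domain := soloInformedPolarBand
  integrand u := 2 * u 1 * (1 + u 0 ^ 2)
  isSemialgebraic_domain := isSemialgebraic_soloInformedPolarBand
  isSemialgebraicFunOn_integrand := by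
    have h := isSemialgebraicFunOn_aeval isSemialgebraic_soloInformedPolarBand
      (MvPolynomial.C 2 * MvPolynomial.X 1 * (1 + MvPolynomial.X 0 ^ 2) : MvPolynomial (Fin 2) ℚ)
    simp only [map_mul, map_add, map_one, map_pow, MvPolynomial.aeval_X, map_ofNat] at h
    exact h
  integrableOn :=
    (((continuous_const.mul (continuous_apply 1)).mul
      (continuous_const.add ((continuous_apply 0).pow 2))).continuousOn).integrableOn_compact
      isCompact_soloInformedPolarBand

/-- Domain of the band representation. -/
@[simp] theorem soloInformedPolarBandRep_domain :
    soloInformedPolarBandRep.domain = soloInformedPolarBand := rfl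

/-- Integrand of the band representation. -/
@[simp] theorem soloInformedPolarBandRep_integrand :
    soloInformedPolarBandRep.integrand = fun u => 2 * u 1 * (1 + u 0 ^ 2) := rfl

/-- The source representation `[source, 2ρ(1 + s²)]` (restriction of the band representation). -/
def soloInformedPolarSrcRep : IntegralRep 2 :=
  soloInformedPolarBandRep.restrict soloInformedPolarSrc isSemialgebraic_soloInformedPolarSrc
    soloInformedPolarSrc_subset_band

/-- **The image of the polar map** is the open first quarter of the closed disc. -/
theorem soloInformed_polar_image :
    soloInformedPolar '' soloInformedPolarSrc = soloInformedQuarterDisc 1 1 := by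
  ext x
  rw [soloInformed_mem_quarterDisc_one_one]
  constructor
  · rintro ⟨u, ⟨h0, h0', h1, h2⟩, rfl⟩
    rw [soloInformedPolar_apply_zero, soloInformedPolar_apply_one]
    have hs : u 0 ^ 2 < 1 := by nlinarith
    have hR : 0 < u 1 * (1 + u 0 ^ 2) := by positivity
    refine ⟨by nlinarith, by positivity, ?_⟩
    calc (u 1 * (1 - u 0 ^ 2)) ^ 2 + (2 * (u 0 * u 1)) ^ 2 = (u 1 * (1 + u 0 ^ 2)) ^ 2 := by ring
      _ ≤ 1 := pow_le_one₀ hR.le h2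
  · rintro ⟨h0, h1, h2⟩
    set R : ℝ := Real.sqrt (x 0 ^ 2 + x 1 ^ 2) with hRdef
    have hR0 : 0 ≤ R := Real.sqrt_nonneg _
    have hR2 : R ^ 2 = x 0 ^ 2 + x 1 ^ 2 := Real.sq_sqrt (by positivity)
    have hR1 : R ≤ 1 := by
      calc R ≤ Real.sqrt 1 := Real.sqrt_le_sqrt h2
        _ = 1 := Real.sqrt_one
    have hx1R : x 1 ≤ R := by
      rw [hRdef]
      exact (Real.le_sqrt h1.le (by positivity)).2 (by nlinarith)
    have hD : 0 < R + x 0 := by linarith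
    refine ⟨![x 1 / (R + x 0), (R + x 0) / 2], ⟨?_, ?_, ?_, ?_⟩, ?_⟩
    · simp only [Matrix.cons_val_zero]
      exact div_pos h1 hD
    · simp only [Matrix.cons_val_zero]
      rw [div_lt_one hD]
      linarith
    · simp only [Matrix.cons_val_one]
      exact half_pos hD
    · simp only [Matrix.cons_val_zero, Matrix.cons_val_one]
      have : (R + x 0) / 2 * (1 + (x 1 / (R + x 0)) ^ 2) = R := by
        field_simp
        nlinarith [hR2]
      rw [this]
      exact hR1
    · have H0 : soloInformedPolar ![x 1 / (R + x 0), (R + x 0) / 2] 0 = x 0 := by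
        rw [soloInformedPolar_apply_zero]
        simp only [Matrix.cons_val_zero, Matrix.cons_val_one]
        field_simp
        nlinarith [hR2]
      have H1 : soloInformedPolar ![x 1 / (R + x 0), (R + x 0) / 2] 1 = x 1 := by
        rw [soloInformedPolar_apply_one]
        simp only [Matrix.cons_val_zero, Matrix.cons_val_one]
        field_simp
      exact funext (Fin.forall_fin_two.2 ⟨H0, H1⟩)

/-- **The polar map is injective** on the source. -/
theorem soloInformed_polar_injOn : InjOn soloInformedPolar soloInformedPolarSrc := by
  intro u hu v hv huv
  obtain ⟨hu0, hu0', hu1, -⟩ := hu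
  obtain ⟨hv0, hv0', hv1, -⟩ := hv
  have e0 : u 1 * (1 - u 0 ^ 2) = v 1 * (1 - v 0 ^ 2) := by
    simpa only [soloInformedPolar_apply_zero] using congr_fun huv 0
  have e1 : 2 * (u 0 * u 1) = 2 * (v 0 * v 1) := by
    simpa only [soloInformedPolar_apply_one] using congr_fun huv 1
  have hRu : 0 < u 1 * (1 + u 0 ^ 2) := by positivity
  have hRv : 0 < v 1 * (1 + v 0 ^ 2) := by positivity
  have hR : u 1 * (1 + u 0 ^ 2) = v 1 * (1 + v 0 ^ 2) := by
    have hsq : (u 1 * (1 + u 0 ^ 2)) ^ 2 = (v 1 * (1 + v 0 ^ 2)) ^ 2 := by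
      calc (u 1 * (1 + u 0 ^ 2)) ^ 2 = (u 1 * (1 - u 0 ^ 2)) ^ 2 + (2 * (u 0 * u 1)) ^ 2 := by
            ring
        _ = (v 1 * (1 - v 0 ^ 2)) ^ 2 + (2 * (v 0 * v 1)) ^ 2 := by rw [e0, e1]
        _ = (v 1 * (1 + v 0 ^ 2)) ^ 2 := by ring
    exact (pow_left_inj₀ hRu.le hRv.le two_ne_zero).1 hsq
  have hρ : u 1 = v 1 := by linear_combination (e0 + hR) / 2
  have hs' : u 0 * v 1 = v 0 * v 1 := by linear_combination e1 / 2 - u 0 * hρ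
  have hs : u 0 = v 0 := mul_right_cancel₀ hv1.ne' hs'
  ext j
  fin_cases j
  · exact hs
  · exact hρ

/-- **Step 3.** `[source, 2ρ(1+s²)] − [first quarter, 1] ∈ relations` (rule (2) for the polar
map). -/
theorem soloInformed_polarSrcRep_sub_quarter_mem_relations :
    of soloInformedPolarSrcRep - of (soloInformedQuarterRep 1 1) ∈ relations := by
  refine changeOfVariablesRel_subset_relations ⟨2, soloInformedPolarSrcRep,
    soloInformedQuarterRep 1 1, soloInformedPolar, soloInformedJacCLM soloInformedPolarPoly,
    isSemialgebraicMapOn_aeval isSemialgebraic_soloInformedPolarSrc soloInformedPolarPoly,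
    fun u _ => (soloInformed_hasFDerivAt_polyMap soloInformedPolarPoly u).hasFDerivWithinAt,
    soloInformed_polar_injOn, soloInformed_polar_image.symm, fun u hu => ?_, rfl⟩
  obtain ⟨-, -, hu1, -⟩ := hu
  show 2 * u 1 * (1 + u 0 ^ 2) = 1 * |(soloInformedJacCLM soloInformedPolarPoly u).det|
  rw [soloInformed_det_polar, abs_neg, abs_of_pos (by positivity), one_mul]

/-! ### Step 4: closing the source -/

/-- **Step 4.** `[band, 2ρ(1+s²)] − [source, 2ρ(1+s²)] ∈ relations` (the difference of the
domains lies in three lines). -/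
theorem soloInformed_polarBandRep_sub_srcRep_mem_relations :
    of soloInformedPolarBandRep - of soloInformedPolarSrcRep ∈ relations := by
  refine soloInformedPolarBandRep.of_sub_of_restrict_mem_relations
    isSemialgebraic_soloInformedPolarSrc soloInformedPolarSrc_subset_band ?_
  -- the three lines `s = 0`, `s = 1`, `ρ = 0` are null (`Measure.pi_hyperplane`)
  have hax : ∀ (i : Fin 2) (c : ℝ), volume {u : Fin 2 → ℝ | u i = c} = 0 := fun i c => by
    rw [volume_pi]; exact Measure.pi_hyperplane _ _ _
  refine measure_mono_null (fun u hu => ?_)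
    (measure_union_null (measure_union_null (hax 0 0) (hax 0 1)) (hax 1 0))
  rcases hu with ⟨⟨⟨h0, h0'⟩, h1, h2⟩, hns⟩
  by_contra hc
  simp only [mem_union, mem_setOf_eq, not_or] at hc
  exact hns ⟨lt_of_le_of_ne h0 (Ne.symm hc.1.1), lt_of_le_of_ne h0' hc.1.2,
    lt_of_le_of_ne h1 (Ne.symm hc.2), h2⟩

/-! ### Step 5: Newton–Leibniz along `ρ` -/

/-- **Step 5.** `[band, 2ρ(1+s²)] − [[0,1], 1/(1+s²)] ∈ relations` (rule (3) with the primitive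
`F(s, ρ) = ρ²(1 + s²)` between `ρ = 0` and `ρ = 1/(1+s²)`). -/
theorem soloInformed_polarBandRep_sub_arctanRep_mem_relations :
    of soloInformedPolarBandRep - of soloInformedArctanRep ∈ relations := by
  set F : (Fin 2 → ℝ) → ℝ := fun u => u 1 ^ 2 * (1 + u 0 ^ 2) with hFdef
  have hsnoc0 : ∀ (x : Fin 1 → ℝ) (t : ℝ), (Fin.snoc x t : Fin 2 → ℝ) 0 = x 0 := fun _ _ => rfl
  have hsnoc1 : ∀ (x : Fin 1 → ℝ) (t : ℝ), (Fin.snoc x t : Fin 2 → ℝ) 1 = t := fun _ _ => rfl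
  have hF : ∀ (x : Fin 1 → ℝ) (t : ℝ), F (Fin.snoc x t) = t ^ 2 * (1 + x 0 ^ 2) := fun x t => by
    simp only [hFdef, hsnoc0, hsnoc1]
  have hFsa : IsSemialgebraicFunOn ℚ soloInformedPolarBandRep.domain F := by
    have h := isSemialgebraicFunOn_aeval isSemialgebraic_soloInformedPolarBand
      (MvPolynomial.X 1 ^ 2 * (1 + MvPolynomial.X 0 ^ 2) : MvPolynomial (Fin 2) ℚ)
    simp only [map_mul, map_add, map_one, map_pow, MvPolynomial.aeval_X] at h
    exact h
  have ha : IsSemialgebraicFunOn ℚ soloInformedArctanRep.domain (fun _ => (0 : ℝ)) := by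
    simpa using isSemialgebraicFunOn_ratCast isSemialgebraic_soloInformedUnitI 0
  have hb : IsSemialgebraicFunOn ℚ soloInformedArctanRep.domain (fun x => 1 / (1 + x 0 ^ 2)) :=
    soloInformed_isSemialgebraicFunOn_arctanFun isSemialgebraic_soloInformedUnitI
  refine newtonLeibnizRel_subset_relations ⟨1, soloInformedPolarBandRep, soloInformedArctanRep,
    fun _ => 0, fun x => 1 / (1 + x 0 ^ 2), F, hFsa, ha, hb, fun x _ => by positivity, ?_,
    fun x _ => ?_, fun x _ t _ => ?_, fun x _ => ?_, rfl⟩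
  · ext z
    simp only [soloInformedPolarBandRep_domain, soloInformedPolarBand, soloInformedArctanRep_domain,
      soloInformedUnitI, mem_setOf_eq, show ∀ z : Fin 2 → ℝ, Fin.init z 0 = z 0 from fun _ => rfl,
      show (Fin.last 1 : Fin 2) = 1 from rfl]
    have hpos : (0 : ℝ) < 1 + z 0 ^ 2 := by positivity
    rw [le_div_iff₀ hpos]
  · have : (fun t : ℝ => F (Fin.snoc x t)) = fun t => t ^ 2 * (1 + x 0 ^ 2) := funext (hF x)
    rw [this]
    exact ((continuous_pow 2).mul continuous_const).continuousOn
  · have : (fun s : ℝ => F (Fin.snoc x s)) = fun s => s ^ 2 * (1 + x 0 ^ 2) := funext (hF x)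
    rw [this, soloInformedPolarBandRep_integrand]
    simp only [hsnoc0, hsnoc1]
    refine ((hasDerivAt_pow 2 t).mul_const (1 + x 0 ^ 2)).congr_deriv ?_
    norm_num
  · rw [hF, hF, soloInformedArctanRep_integrand]
    have hpos : (1 : ℝ) + x 0 ^ 2 ≠ 0 := by positivity
    field_simp
    ring

/-! ### Assembly -/

/-- The first quarter is equivalent to the arctangent representation. -/
theorem soloInformed_quarter_sub_arctanRep_mem_relations :
    of (soloInformedQuarterRep 1 1) - of soloInformedArctanRep ∈ relations := by
  have e : of (soloInformedQuarterRep 1 1) - of soloInformedArctanRep =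
      -(of soloInformedPolarSrcRep - of (soloInformedQuarterRep 1 1)) -
        (of soloInformedPolarBandRep - of soloInformedPolarSrcRep) +
        (of soloInformedPolarBandRep - of soloInformedArctanRep) := by abel
  rw [e]
  exact relations.add_mem (relations.sub_mem
    (relations.neg_mem soloInformed_polarSrcRep_sub_quarter_mem_relations)
    soloInformed_polarBandRep_sub_srcRep_mem_relations)
    soloInformed_polarBandRep_sub_arctanRep_mem_relations

/-- **Kontsevich–Zagier's first example inside the four-move calculus**:
`[{x² + y² ≤ 1}, 1] − 4 · [[0,1], 1/(1+t²)] ∈ KZ.relations`, i.e. `π = 4 ∫₀¹ dt/(1+t²)` holds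
in the formal period group `FormalRep ⧸ relations`. [Kontsevich–Zagier 2001, §1.1–§1.2] -/
theorem soloInformed_piRep_sub_four_nsmul_arctanRep_mem_relations :
    of piRep - 4 • of soloInformedArctanRep ∈ relations := by
  have h1 := soloInformed_piRep_sub_sum_quarter_mem_relations
  rw [Fin.sum_univ_four] at h1
  have h2 := soloInformed_quarter_sub_quarter_zero_mem_relations
  have h3 : of (soloInformedQuarter 0) - of soloInformedArctanRep ∈ relations :=
    soloInformed_quarter_sub_arctanRep_mem_relations
  have e : of piRep - 4 • of soloInformedArctanRep =
      (of piRep - (of (soloInformedQuarter 0) + of (soloInformedQuarter 1) +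
        of (soloInformedQuarter 2) + of (soloInformedQuarter 3))) +
      ((of (soloInformedQuarter 1) - of (soloInformedQuarter 0)) +
        (of (soloInformedQuarter 2) - of (soloInformedQuarter 0)) +
        (of (soloInformedQuarter 3) - of (soloInformedQuarter 0))) +
      4 • (of (soloInformedQuarter 0) - of soloInformedArctanRep) := by abel
  rw [e]
  exact relations.add_mem (relations.add_mem h1
    (relations.add_mem (relations.add_mem (h2 1) (h2 2)) (h2 3))) (relations.nsmul_mem h3 4)

/-- The same statement as an equivalence of representations up to the factor `4`:
`[disc, 1] ∼ [[0,1], 4/(1+t²)]`. -/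
theorem soloInformed_piRep_equivalent_constMul_arctanRep :
    Equivalent piRep (soloInformedArctanRep.constMul ((4 : ℕ) : ℝ) (isAlgebraic_nat 4)) := by
  have h := soloInformedArctanRep.of_constMul_nat_sub_nsmul_mem_relations 4
  have e : of piRep - of (soloInformedArctanRep.constMul ((4 : ℕ) : ℝ) (isAlgebraic_nat 4)) =
      (of piRep - 4 • of soloInformedArctanRep) -
        (of (soloInformedArctanRep.constMul ((4 : ℕ) : ℝ) (isAlgebraic_nat 4)) -
          4 • of soloInformedArctanRep) := by abel
  show of piRep - of _ ∈ relations
  rw [e]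
  exact relations.sub_mem soloInformed_piRep_sub_four_nsmul_arctanRep_mem_relations h

end Summit.KontsevichZagierPeriods.KontsevichZagierPeriods.Theorems
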